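import Summits.NavierStokesRegularity.NavierStokesRegularity.Theorems.OddMorawetzLocal.Negative.OddMorawetzLocalJetAlgebra
import HarnessLib

/-!
# Normal forms preserve values; the coefficient cast commutes with the jet algebra

Crux `OddMorawetzLocal` (item stmt-NavierStokesRegularity-1376), refutation skeleton, stub `evalA_norm_cast`.
Pure list algebra over Mathlib on the computable jet polynomials `JPoly R = List (R × List JVar)` of
`OddMorawetzLocalJetAlgebra`; no named facts.

The refutation computes with rational jet polynomials in the kernel (`decide`): normal forms `JPoly.norm`, the
divergence-free normal form `JPoly.nf`, total derivatives `JPoly.D`; the analysis sees the real-valued semantics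
`JPoly.evalA` of the cast polynomials `JPoly.cast : JPoly ℚ → JPoly ℝ`.  This file proves the two bridges:

* `evalA_collect`, `evalA_norm` — sorting the variables of each monomial (`sortVars`, a permutation), merging equal
  monomials (`insertTerm`, whose merge branch fires only on *equal* monomials: `eq_of_monoCmp_eq`) and dropping zero
  coefficients do not change the value `evalA p ζ`;
* `cast_append`, `cast_smul`, `cast_neg`, `cast_mul`, `cast_prodList`, `cast_subst`, `cast_insertTerm`,
  `cast_collect`, `cast_filter`, `cast_norm`, `cast_D`, `cast_nfVar`, `cast_nf` — the coefficient cast `ℚ → ℝ` is a `List.map` and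
  a ring homomorphism on coefficients, injective (so `c ≠ 0 ↔ (c : ℝ) ≠ 0` for the zero filter), and the monomial
  bookkeeping (`monoCmp`, `sortVars`, `derivVars`, `nfVar`'s case split) never looks at coefficients.

They are assembled in `evalA_norm_cast` (the registered signature), so that a `decide`d identity over `ℚ` such as
`JPoly.nf q = []` transports to `JPoly.evalA (JPoly.nf (JPoly.cast q)) ζ = 0` over `ℝ`.
-/

noncomputable section

set_option linter.dupNamespace false
set_option autoImplicit false

namespace Summit.NavierStokesRegularity.NavierStokesRegularity.Theorems.OddMorawetz

/-! ### The comparisons answer `eq` only on equal arguments -/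

/-- `idxCmp l l' = eq` only if `l = l'`. -/
theorem eq_of_idxCmp_eq : ∀ (l l' : List (Fin 3)), idxCmp l l' = Ordering.eq → l = l' := by
  intro l
  induction l with
  | nil =>
    intro l' h
    cases l' with
    | nil => rfl
    | cons j js => exact absurd h (by simp [idxCmp])
  | cons i is ih =>
    intro l' h
    cases l' with
    | nil => exact absurd h (by simp [idxCmp])
    | cons j js =>
      simp only [idxCmp] at h
      by_cases h₁ : i < j
      · rw [if_pos h₁] at h; exact absurd h (by decide)
      rw [if_neg h₁] at h
      by_cases h₂ : j < i
      · rw [if_pos h₂] at h; exact absurd h (by decide)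
      rw [if_neg h₂] at h
      obtain rfl : i = j := le_antisymm (not_lt.mp h₂) (not_lt.mp h₁)
      rw [ih js h]

/-- `JVar.cmp v w = eq` only if `v = w`. -/
theorem eq_of_jvarCmp_eq (v w : JVar) (h : JVar.cmp v w = Ordering.eq) : v = w := by
  unfold JVar.cmp at h
  by_cases h₁ : v.1 < w.1
  · rw [if_pos h₁] at h; exact absurd h (by decide)
  rw [if_neg h₁] at h
  by_cases h₂ : w.1 < v.1
  · rw [if_pos h₂] at h; exact absurd h (by decide)
  rw [if_neg h₂] at h
  exact Prod.ext (le_antisymm (not_lt.mp h₂) (not_lt.mp h₁)) (eq_of_idxCmp_eq _ _ h)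

/-- `monoCmp m m' = eq` only if `m = m'`: the merge branch of `JPoly.insertTerm` adds coefficients of the SAME
monomial. -/
theorem eq_of_monoCmp_eq : ∀ (m m' : List JVar), monoCmp m m' = Ordering.eq → m = m' := by
  intro m
  induction m with
  | nil =>
    intro m' h
    cases m' with
    | nil => rfl
    | cons w ws => exact absurd h (by simp [monoCmp])
  | cons v vs ih =>
    intro m' h
    cases m' with
    | nil => exact absurd h (by simp [monoCmp])
    | cons w ws =>
      cases hc : JVar.cmp v w with
      | lt => simp [monoCmp, hc] at h
      | gt => simp [monoCmp, hc] at h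
      | eq =>
        simp only [monoCmp, hc] at h
        obtain rfl := eq_of_jvarCmp_eq v w hc
        rw [ih ws h]

/-! ### Sorting the variables of a monomial is a permutation -/

/-- Sorted insertion of a variable permutes `v :: l`. -/
theorem insertVar_perm (v : JVar) : ∀ (l : List JVar), (insertVar v l).Perm (v :: l)
  | [] => List.Perm.refl _
  | w :: ws => by
    simp only [insertVar]
    split
    · exact ((insertVar_perm v ws).cons w).trans (List.Perm.swap v w ws)
    · exact List.Perm.refl _

/-- `sortVars m` is a permutation of `m`. -/
theorem sortVars_perm : ∀ (m : List JVar), (sortVars m).Perm m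
  | [] => List.Perm.refl _
  | v :: vs => (insertVar_perm v (sortVars vs)).trans ((sortVars_perm vs).cons v)

/-- Hence a monomial and its sorted form have the same value. -/
theorem prod_map_sortVars (m : List JVar) (ζ : JVar → ℝ) : ((sortVars m).map ζ).prod = (m.map ζ).prod :=
  ((sortVars_perm m).map ζ).prod_eq

/-! ### `evalA` of `collect` and `norm` -/

/-- `evalA` of the empty polynomial. -/
@[simp] theorem evalA_nil (ζ : JVar → ℝ) : JPoly.evalA ([] : JPoly ℝ) ζ = 0 := by
  simp [JPoly.evalA]

/-- `evalA` of a cons: the value of the head term plus the value of the tail. -/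
@[simp] theorem evalA_cons (t : ℝ × List JVar) (p : JPoly ℝ) (ζ : JVar → ℝ) :
    JPoly.evalA (t :: p) ζ = t.1 * (t.2.map ζ).prod + JPoly.evalA p ζ := by
  simp [JPoly.evalA]

/-- Inserting a term adds its value (the merge branch only ever merges equal monomials). -/
theorem evalA_insertTerm (c : ℝ) (m : List JVar) (ζ : JVar → ℝ) :
    ∀ q : JPoly ℝ, JPoly.evalA (JPoly.insertTerm c m q) ζ = c * (m.map ζ).prod + JPoly.evalA q ζ
  | [] => by simp [JPoly.insertTerm]
  | (c', m') :: rest => by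
    cases hc : monoCmp m m' with
    | lt => simp [JPoly.insertTerm, hc]
    | eq =>
      obtain rfl := eq_of_monoCmp_eq m m' hc
      simp only [JPoly.insertTerm, hc, evalA_cons]
      ring
    | gt =>
      simp only [JPoly.insertTerm, hc, evalA_cons, evalA_insertTerm c m ζ rest]
      ring

/-- **Collecting does not change the value.** -/
theorem evalA_collect (p : JPoly ℝ) (ζ : JVar → ℝ) : JPoly.evalA (JPoly.collect p) ζ = JPoly.evalA p ζ := by
  induction p with
  | nil => rfl
  | cons t p ih =>
    show JPoly.evalA (JPoly.insertTerm t.1 (sortVars t.2) (JPoly.collect p)) ζ = _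
    rw [evalA_insertTerm, ih, evalA_cons, prod_map_sortVars]

/-- **Normalising does not change the value** (zero coefficients contribute zero). -/
theorem evalA_norm (p : JPoly ℝ) (ζ : JVar → ℝ) : JPoly.evalA (JPoly.norm p) ζ = JPoly.evalA p ζ := by
  rw [← evalA_collect p ζ]
  unfold JPoly.norm
  generalize JPoly.collect p = q
  induction q with
  | nil => rfl
  | cons t q ih =>
    rw [List.filter_cons]
    split_ifs with h
    · rw [evalA_cons, evalA_cons, ih]
    · have h0 : t.1 = 0 := by simpa using h
      rw [evalA_cons, ih, h0, zero_mul, zero_add]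

/-! ### The coefficient cast commutes with the list algebra -/

/-- `cast` of the empty polynomial. -/
@[simp] theorem cast_nil : JPoly.cast ([] : JPoly ℚ) = [] := rfl

/-- `cast` of a cons. -/
@[simp] theorem cast_cons (t : ℚ × List JVar) (p : JPoly ℚ) :
    JPoly.cast (t :: p) = ((t.1 : ℝ), t.2) :: JPoly.cast p := rfl

/-- `cast` commutes with concatenation (= `JPoly.add`). -/
theorem cast_append (p q : JPoly ℚ) : JPoly.cast (p ++ q) = JPoly.cast p ++ JPoly.cast q := by
  simp [JPoly.cast]

/-- `cast` commutes with scalar multiplication. -/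
theorem cast_smul (c : ℚ) (p : JPoly ℚ) : JPoly.cast (JPoly.smul c p) = JPoly.smul (c : ℝ) (JPoly.cast p) := by
  simp only [JPoly.cast, JPoly.smul, List.map_map]
  congr 1
  funext t
  simp

/-- `cast` commutes with negation. -/
theorem cast_neg (p : JPoly ℚ) : JPoly.cast (JPoly.neg p) = JPoly.neg (JPoly.cast p) := by
  simp only [JPoly.cast, JPoly.neg, List.map_map]
  congr 1
  funext t
  simp

/-- `cast` commutes with the product. -/
theorem cast_mul (p q : JPoly ℚ) : JPoly.cast (JPoly.mul p q) = JPoly.mul (JPoly.cast p) (JPoly.cast q) := by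
  simp only [JPoly.cast, JPoly.mul, List.map_flatMap, List.flatMap_map, List.map_map]
  congr 1
  funext s
  congr 1
  funext t
  simp

/-- `cast` commutes with the product of a list. -/
theorem cast_prodList : ∀ (ps : List (JPoly ℚ)), JPoly.cast (JPoly.prodList ps) = JPoly.prodList (ps.map JPoly.cast)
  | [] => by simp [JPoly.prodList, JPoly.cast]
  | p :: ps => by
    rw [JPoly.prodList, cast_mul, cast_prodList ps]
    rfl

/-- `cast` commutes with substitution, for compatible substitutions. -/
theorem cast_subst (σ : JVar → JPoly ℚ) (σ' : JVar → JPoly ℝ) (hσ : ∀ v, JPoly.cast (σ v) = σ' v) (p : JPoly ℚ) :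
    JPoly.cast (JPoly.subst σ p) = JPoly.subst σ' (JPoly.cast p) := by
  have hl : ∀ l : List JVar, (l.map σ).map JPoly.cast = l.map σ' := fun l => by
    rw [List.map_map]
    exact List.map_congr_left fun v _ => hσ v
  induction p with
  | nil => rfl
  | cons t p ih =>
    simp only [JPoly.subst, List.flatMap_cons] at ih ⊢
    rw [cast_cons, List.flatMap_cons, cast_append, ih, ← hl t.2, ← cast_prodList]
    congr 1
    simp only [JPoly.cast, List.map_map]
    congr 1
    funext s
    simp

/-- `cast` commutes with sorted insertion of a term (`monoCmp` ignores coefficients; `Rat.cast_add`). -/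
theorem cast_insertTerm (c : ℚ) (m : List JVar) : ∀ q : JPoly ℚ,
    JPoly.cast (JPoly.insertTerm c m q) = JPoly.insertTerm (c : ℝ) m (JPoly.cast q)
  | [] => rfl
  | (c', m') :: rest => by
    cases hc : monoCmp m m' with
    | lt => simp [JPoly.insertTerm, hc]
    | eq => simp [JPoly.insertTerm, hc]
    | gt =>
      simp only [JPoly.insertTerm, hc, cast_cons]
      rw [cast_insertTerm c m rest]

/-- `cast` commutes with `collect`. -/
theorem cast_collect (p : JPoly ℚ) : JPoly.cast (JPoly.collect p) = JPoly.collect (JPoly.cast p) := by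
  induction p with
  | nil => rfl
  | cons t p ih =>
    show JPoly.cast (JPoly.insertTerm t.1 (sortVars t.2) (JPoly.collect p)) =
      JPoly.insertTerm (t.1 : ℝ) (sortVars t.2) (JPoly.collect (JPoly.cast p))
    rw [cast_insertTerm, ih]

/-- `cast` commutes with filters along compatible Boolean predicates. -/
theorem cast_filter (P : ℚ × List JVar → Bool) (P' : ℝ × List JVar → Bool)
    (h : ∀ t, P' ((t.1 : ℝ), t.2) = P t) (q : JPoly ℚ) :
    JPoly.cast (q.filter P) = (JPoly.cast q).filter P' := by
  unfold JPoly.cast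
  rw [List.filter_map]
  congr 2
  funext t
  exact (h t).symm

/-- `cast` commutes with `norm` (the cast is injective, so the zero filters agree: `Rat.cast_eq_zero`). -/
theorem cast_norm (p : JPoly ℚ) : JPoly.cast (JPoly.norm p) = JPoly.norm (JPoly.cast p) := by
  unfold JPoly.norm
  rw [← cast_collect]
  exact cast_filter _ _ (fun t => by simp) _

/-- `cast` commutes with the total derivative `D i`. -/
theorem cast_D (i : Fin 3) (p : JPoly ℚ) : JPoly.cast (JPoly.D i p) = JPoly.D i (JPoly.cast p) := by
  simp only [JPoly.cast, JPoly.D, List.map_flatMap, List.flatMap_map, List.map_map]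
  congr 1

/-- `cast` maps the rational `nfVar v` to the real one. -/
theorem cast_nfVar (v : JVar) : JPoly.cast (JPoly.nfVar v : JPoly ℚ) = (JPoly.nfVar v : JPoly ℝ) := by
  unfold JPoly.nfVar
  split_ifs <;> simp [JPoly.cast]

/-- `cast` commutes with the divergence-free normal form. -/
theorem cast_nf (p : JPoly ℚ) : JPoly.cast (JPoly.nf p) = JPoly.nf (JPoly.cast p) := by
  unfold JPoly.nf
  rw [cast_norm, cast_subst JPoly.nfVar JPoly.nfVar cast_nfVar]

/-! ### The registered stub -/

/-- **Stub `evalA_norm_cast` of crux `OddMorawetzLocal` (refutation).**  Collecting / normalising a real jet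
polynomial does not change its value, and the coefficient cast `ℚ → ℝ` commutes with concatenation, scalar
multiplication, negation, product, normal form, total derivatives and the divergence-free normal form. -/
theorem evalA_norm_cast :
    (∀ (p : JPoly ℝ) (ζ : JVar → ℝ), JPoly.evalA (JPoly.collect p) ζ = JPoly.evalA p ζ) ∧
    (∀ (p : JPoly ℝ) (ζ : JVar → ℝ), JPoly.evalA (JPoly.norm p) ζ = JPoly.evalA p ζ) ∧
    (∀ (p q : JPoly ℚ), JPoly.cast (p ++ q) = JPoly.cast p ++ JPoly.cast q) ∧
    (∀ (c : ℚ) (p : JPoly ℚ), JPoly.cast (JPoly.smul c p) = JPoly.smul (c : ℝ) (JPoly.cast p)) ∧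
    (∀ (p : JPoly ℚ), JPoly.cast (JPoly.neg p) = JPoly.neg (JPoly.cast p)) ∧
    (∀ (p q : JPoly ℚ), JPoly.cast (JPoly.mul p q) = JPoly.mul (JPoly.cast p) (JPoly.cast q)) ∧
    (∀ (p : JPoly ℚ), JPoly.cast (JPoly.norm p) = JPoly.norm (JPoly.cast p)) ∧
    (∀ (i : Fin 3) (p : JPoly ℚ), JPoly.cast (JPoly.D i p) = JPoly.D i (JPoly.cast p)) ∧
    (∀ (p : JPoly ℚ), JPoly.cast (JPoly.nf p) = JPoly.nf (JPoly.cast p)) :=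
  ⟨evalA_collect, evalA_norm, cast_append, cast_smul, cast_neg, cast_mul, cast_norm, cast_D, cast_nf⟩

end Summit.NavierStokesRegularity.NavierStokesRegularity.Theorems.OddMorawetz

end
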